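import Mathlib
import Literature.Analysis.FluidPDE.Tao2016AveragedNS.ShiftSetCascadeFlows
import Summits.NavierStokesRegularity.NavierStokesRegularity.Theorems.TaoLadderRungTwoFlatCertificateGlueFlowStepOn
import HarnessLib

/-!
# Certificate glue on a shift set `𝕊`, XIV-b: INPUTS DECOUPLED, GENERAL NODE SETS — `StepCert` from an exact-flow step
  enclosure between ARBITRARY start / landing predicates (parallelepipeds, unions of boxes, …) plus the Grönwall
  allowance (helper for items stmt-NavierStokesRegularity-22987 `FlatGapCertificatesV2` and stmt-24295 K_A₂(64);
  cell harvest/h2-tao-ladder, p1 g14)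

`stepCert_of_flowStep'`: glue XIV (`stepCert_of_flowStep`) with the node box `[Nlo, Nhi]` replaced by an arbitrary
start predicate `Start ⊇ Node j` and the landing box `[N'lo, N'hi]` by an arbitrary landing predicate `Land`; the next
node must contain every state within the Grönwall allowance `A·ω` (componentwise on the window) of SOME state of `Land`.
This is the shape a Lohner / Taylor-model step produces (node sets = parallelepipeds `x + C ξ + e`): the allowance is
absorbed into the remainder part `e`. The hull stays a box (it only has to sit inside the `M`-box). Proof = glue XIV's,
verbatim up to the last two lines.

HONEST FRAMING: Tao-type MODEL lattices (Tao 2016 §4/§6 vocabulary, shift-set parametrised); every enclosure /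
bound is a HYPOTHESIS — nothing is computed or certified here, no stub is closed, nothing about the Navier–Stokes
equations.
-/

noncomputable section

-- the sub-problem namespace repeats the summit name by design (D-0017)
set_option linter.dupNamespace false

namespace Summit.NavierStokesRegularity.NavierStokesRegularity.Theorems

open Set Filter Topology Literature.Analysis.FluidPDE Literature.Analysis.FluidPDE.TaoCascade

namespace CertificateGlueOn

variable {m : ℕ} {𝕊 : Finset (ℤ × ℤ × ℤ)} {ε₀ : ℝ} {α : Fin m → Fin m → Fin m → ℤ × ℤ × ℤ → ℝ} {Kb Ka : ℤ}
  {Eb Et : ℝ} {ω : ℤ → ℝ}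

/-- **`StepCert` FROM AN EXACT-FLOW STEP ENCLOSURE BETWEEN GENERAL START / LANDING PREDICATES PLUS A GRÖNWALL
ALLOWANCE FOR THE INPUTS** (see the module docstring). [cite: MooreKearfottCloud2009, §9–10 (interval enclosure of ODE solutions); cell certificate format, mesh layer] -/
theorem stepCert_of_flowStep' (hKb : 0 ≤ Kb) (hKa : 1 ≤ Ka) (hω : ∀ k, 0 < ω k)
    {M : ℤ → ℝ} {t : ℕ → ℝ} {Node Hull : ℕ → (Fin m → ℤ → ℝ) → Prop} {j : ℕ}
    {Start Land : (Fin m → ℤ → ℝ) → Prop}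
    {Hlo Hhi glo ghi : Fin m → ℤ → ℝ} {K δ A : ℝ} (hK : 0 ≤ K) (hδ : 0 ≤ δ)
    (hN : ∀ y, Node j y → Start y)
    (hGM : ∀ i k, -Kb ≤ k → k ≤ Ka → glo i k ≤ -M k ∧ M k ≤ ghi i k)
    (hGH : ∀ i k, -Kb ≤ k → k ≤ Ka → glo i k ≤ Hlo i k ∧ Hhi i k ≤ ghi i k)
    (hlip : FieldLipOn 𝕊 ε₀ α Kb Ka ω glo ghi K) (hdef : InputDefectOn 𝕊 ε₀ α Kb Ka Eb Et ω glo ghi δ)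
    (hflow : ∀ z : Fin m → ℤ → ℝ, Start z → ∃ ψ : Fin m → ℤ → ℝ → ℝ,
      (∀ i k, -Kb ≤ k → k ≤ Ka → ψ i k 0 = z i k) ∧
      (∀ i k, -Kb ≤ k → k ≤ Ka → ∀ u ∈ Icc 0 (t (j + 1) - t j),
        HasDerivWithinAt (ψ i k) (truncField 𝕊 ε₀ α Kb Ka (slice ψ u) i k) (Icc 0 (t (j + 1) - t j)) u) ∧
      (∀ u ∈ Icc 0 (t (j + 1) - t j), InBoxOn Kb Ka Hlo Hhi (slice ψ u)) ∧
      Land (slice ψ (t (j + 1) - t j)))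
    (hA : gronwallBound 0 K δ (t (j + 1) - t j) ≤ A)
    (hH : ∀ y : Fin m → ℤ → ℝ,
      (∀ i k, -Kb ≤ k → k ≤ Ka → Hlo i k - A * ω k ≤ y i k ∧ y i k ≤ Hhi i k + A * ω k) → Hull j y)
    (hN' : ∀ y p : Fin m → ℤ → ℝ, Land p →
      (∀ i k, -Kb ≤ k → k ≤ Ka → |y i k - p i k| ≤ A * ω k) → Node (j + 1) y) :
    StepCert 𝕊 ε₀ α Kb Ka Eb Et M t Node Hull j := by
  intro s S hs hsh hnode hrun hM
  have hKK : 0 ≤ Ka + Kb + 1 := by omega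
  set h := t (j + 1) - t j with hh
  obtain ⟨ψ, hψ0, hψd, hψH, hψN⟩ := hflow (slice S 0) (hN _ hnode)
  -- weighted coordinates of the run and of the exact solution
  set f : ℝ → (Fin m × Fin (winLen Kb Ka) → ℝ) := fun u => wcoord Kb Ka ω (slice S u) with hf
  set g : ℝ → (Fin m × Fin (winLen Kb Ka) → ℝ) := fun u => wcoord Kb Ka ω (slice ψ u) with hg
  set v : (Fin m × Fin (winLen Kb Ka) → ℝ) → (Fin m × Fin (winLen Kb Ka) → ℝ) :=
    fun x => wcoord Kb Ka ω (truncField 𝕊 ε₀ α Kb Ka (wstate Kb Ka ω x)) with hv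
  set T : Set (Fin m × Fin (winLen Kb Ka) → ℝ) := {x | InBoxOn Kb Ka glo ghi (wstate Kb Ka ω x)} with hT
  -- Lipschitz bound of `v` on `T`
  have hvlip : LipschitzOnWith K.toNNReal v T := by
    refine LipschitzOnWith.of_dist_le_mul fun x hx x' hx' => ?_
    rw [Real.coe_toNNReal K hK]
    refine dist_wcoord_le hω hKK (mul_nonneg hK dist_nonneg) fun i k hk1 hk2 => ?_
    have := hlip (wstate Kb Ka ω x) (wstate Kb Ka ω x') (dist x x') dist_nonneg hx hx'
      (fun i' k' hk1' hk2' => abs_wstate_sub_le hω hKK x x' i' hk1' hk2') i k hk1 hk2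
    exact this
  -- the run: derivative, continuity, defect, region
  have hSd : ∀ u ∈ Ico 0 s, HasDerivWithinAt f
      (wcoord Kb Ka ω (fun i k => quadTermOn 𝕊 ε₀ α S i k u)) (Ici u) u := by
    intro u hu
    have hmem : Icc 0 s ∈ 𝓝[≥] u := mem_of_superset (Icc_mem_nhdsGE hu.2) (Icc_subset_Icc_left hu.1)
    refine HasDerivWithinAt.mono_of_mem_nhdsWithin ?_ hmem
    rw [hasDerivWithinAt_pi]
    intro c
    obtain ⟨h1, h2⟩ := shellAt_mem hKK c.2
    have := (hrun.deriv c.1 _ h1 h2 u (Ico_subset_Icc_self hu)).div_const (ω (shellAt Kb c.2))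
    simpa [hf, wcoord, slice] using this
  have hSc : ContinuousOn f (Icc 0 s) := by
    rw [continuousOn_pi]
    intro c
    obtain ⟨h1, h2⟩ := shellAt_mem hKK c.2
    simpa [hf, wcoord, slice] using (hrun.continuousOn c.1 h1 h2).div_const (ω (shellAt Kb c.2))
  have hST : ∀ u ∈ Ico 0 s, f u ∈ T := by
    intro u hu i k hk1 hk2
    simp only [hf]
    rw [wstate_wcoord hω _ i hk1 hk2, slice_apply]
    have hb := abs_le.mp (hM i k hk1 hk2 u (Ico_subset_Icc_self hu))
    have hg' := hGM i k hk1 hk2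
    exact ⟨hg'.1.trans hb.1, hb.2.trans hg'.2⟩
  have hSdef : ∀ u ∈ Ico 0 s,
      dist (wcoord Kb Ka ω (fun i k => quadTermOn 𝕊 ε₀ α S i k u)) (v (f u)) ≤ δ := by
    intro u hu
    have hu' := Ico_subset_Icc_self hu
    simp only [hv, hf]
    rw [truncField_wstate_wcoord 𝕊 ε₀ α hω]
    refine dist_wcoord_le hω hKK hδ fun i k hk1 hk2 => ?_
    have hY : InBoxOn Kb Ka glo ghi (slice S u) := fun i' k' hk1' hk2' => by
      have hb := abs_le.mp (hM i' k' hk1' hk2' u hu')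
      have hg' := hGM i' k' hk1' hk2'
      simp only [slice_apply]
      exact ⟨hg'.1.trans hb.1, hb.2.trans hg'.2⟩
    have := hdef (slice S u) hY (fun i' => by simpa [slice] using hrun.bound_bot i' u hu')
      (fun i' => by simpa [slice] using hrun.bound_top i' u hu') i k hk1 hk2
    rwa [quadTermOn_slice] at this
  -- the exact solution: derivative, continuity, region
  have hψd' : ∀ u ∈ Ico 0 s, HasDerivWithinAt g (v (g u)) (Ici u) u := by
    intro u hu
    have hus : u < h := lt_of_lt_of_le hu.2 hsh
    have hmem : Icc 0 h ∈ 𝓝[≥] u := mem_of_superset (Icc_mem_nhdsGE hus) (Icc_subset_Icc_left hu.1)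
    refine HasDerivWithinAt.mono_of_mem_nhdsWithin ?_ hmem
    rw [hasDerivWithinAt_pi]
    intro c
    obtain ⟨h1, h2⟩ := shellAt_mem hKK c.2
    have := (hψd c.1 _ h1 h2 u ⟨hu.1, hus.le⟩).div_const (ω (shellAt Kb c.2))
    simp only [hv, hg]
    rw [truncField_wstate_wcoord 𝕊 ε₀ α hω]
    simpa [wcoord, slice] using this
  have hψc : ContinuousOn g (Icc 0 s) := by
    rw [continuousOn_pi]
    intro c
    obtain ⟨h1, h2⟩ := shellAt_mem hKK c.2
    have : ContinuousOn (ψ c.1 (shellAt Kb c.2)) (Icc 0 h) := fun u hu =>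
      (hψd c.1 _ h1 h2 u hu).continuousWithinAt
    simpa [hg, wcoord, slice] using (this.mono (Icc_subset_Icc_right hsh)).div_const (ω (shellAt Kb c.2))
  have hψT : ∀ u ∈ Ico 0 s, g u ∈ T := by
    intro u hu i k hk1 hk2
    simp only [hg]
    rw [wstate_wcoord hω _ i hk1 hk2]
    have hb := hψH u ⟨hu.1, (lt_of_lt_of_le hu.2 hsh).le⟩ i k hk1 hk2
    have hg' := hGH i k hk1 hk2
    exact ⟨hg'.1.trans hb.1, hb.2.trans hg'.2⟩
  have hψdef : ∀ u ∈ Ico 0 s, dist (v (g u)) (v (g u)) ≤ 0 := fun u _ => by rw [dist_self]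
  -- same start
  have h0 : dist (f 0) (g 0) ≤ 0 := by
    refine le_of_eq (dist_eq_zero.2 ?_)
    funext c
    obtain ⟨h1, h2⟩ := shellAt_mem hKK c.2
    simp only [hf, hg, wcoord, slice_apply, hψ0 c.1 _ h1 h2]
  -- Grönwall
  have hgr := dist_le_of_approx_trajectories_ODE_of_mem (v := fun _ => v) (s := fun _ => T)
    (fun u _ => hvlip) hSc hSd hSdef hST hψc hψd' hψdef hψT h0
  -- componentwise extraction
  have hdev : ∀ u ∈ Icc 0 s, ∀ i k, -Kb ≤ k → k ≤ Ka → |S i k u - ψ i k u| ≤ A * ω k := by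
    intro u hu i k hk1 hk2
    have h1 := abs_sub_le_dist_wcoord hω hKK (slice S u) (slice ψ u) i hk1 hk2
    simp only [slice_apply] at h1
    have h2 := hgr u hu
    rw [add_zero, sub_zero, Real.coe_toNNReal K hK] at h2
    have h3 : gronwallBound 0 K δ u ≤ A :=
      (gronwallBound_mono hK hδ (hu.2.trans hsh)).trans hA
    calc |S i k u - ψ i k u| ≤ dist (f u) (g u) * ω k := h1
      _ ≤ A * ω k := mul_le_mul_of_nonneg_right (h2.trans h3) (hω k).le
  refine ⟨fun u hu => hH _ fun i k hk1 hk2 => ?_, fun hsfull => ?_⟩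
  · have hd := abs_le.mp (hdev u hu i k hk1 hk2)
    have hb := hψH u ⟨hu.1, hu.2.trans hsh⟩ i k hk1 hk2
    simp only [slice_apply] at hb ⊢
    constructor <;> linarith [hd.1, hd.2, hb.1, hb.2]
  · refine hN' _ (slice ψ s) (by rw [hsfull]; exact hψN) fun i k hk1 hk2 => ?_
    simpa [slice_apply] using hdev s ⟨hs.le, le_rfl⟩ i k hk1 hk2


end CertificateGlueOn

end Summit.NavierStokesRegularity.NavierStokesRegularity.Theorems

end
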